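import Mathlib
import Summits.Ventures.PercRepro.PuncturedLYMMixP1Q2Table1
import Summits.Ventures.PercRepro.PuncturedLYMMixP1Q2Rows1

/-!
# PercRepro — (SP) FOR `1` PAIRWISE DISJOINT PAIRS AND `2` PAIRWISE DISJOINT QUADRUPLES AT LEVEL `4`: THE ROW IDENTITIES, ASSEMBLED
(p10, gen 41)

`row_check`: the row identity of every class (`mass ≤ 4`, the touched bounds `≤ 1` / `≤ 2`), by nested `interval_cases` over the class counts.  Nothing here asserts (SP).
-/

namespace PercRepro.PuncturedLYM.Split.TypeLift.MixP1Q2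

/-- The row identity of every class, in one statement. -/
theorem row_check (n : ℚ) (hd : den n ≠ 0) (hPc : Pc n ≠ 0) (c21 c41 c42 c43 : ℕ)
    (h : c21 + c41 + 2 * c42 + 3 * c43 ≤ 4) (hA : c21 ≤ 1) (hB : c41 + c42 + c43 ≤ 2) :
    2 * ((1 : ℚ) - ((c21 : ℚ))) * raw n c21 c41 c42 c43 0 + (c21 : ℚ) / 2 + 4 * ((2 : ℚ) - ((c41 : ℚ) + c42 + c43)) * raw n c21 c41 c42 c43 2 + 3 * (c41 : ℚ) * raw n c21 c41 c42 c43 3 + 2 * (c42 : ℚ) * raw n c21 c41 c42 c43 4 + (c43 : ℚ) / 4 +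
      (n - 10 - ((4 : ℚ) - c21 - c41 - 2 * c42 - 3 * c43)) * raw n c21 c41 c42 c43 6 = Yc n / Pc n := by
  have hb4 : c43 ≤ 1 := by omega
  interval_cases c43
  · have hb3 : c42 ≤ 2 := by omega
    interval_cases c42
    · have hb2 : c41 ≤ 2 := by omega
      interval_cases c41
      · have hb1 : c21 ≤ 1 := by omega
        interval_cases c21
        · push_cast
          linear_combination row_0000 n hd hPc
        · push_cast
          linear_combination row_1000 n hd hPc
      · have hb1 : c21 ≤ 1 := by omega
        interval_cases c21
        · push_cast
          linear_combination row_0100 n hd hPc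
        · push_cast
          linear_combination row_1100 n hd hPc
      · have hb1 : c21 ≤ 1 := by omega
        interval_cases c21
        · push_cast
          linear_combination row_0200 n hd hPc
        · push_cast
          linear_combination row_1200 n hd hPc
    · have hb2 : c41 ≤ 1 := by omega
      interval_cases c41
      · have hb1 : c21 ≤ 1 := by omega
        interval_cases c21
        · push_cast
          linear_combination row_0010 n hd hPc
        · push_cast
          linear_combination row_1010 n hd hPc
      · have hb1 : c21 ≤ 1 := by omega
        interval_cases c21
        · push_cast
          linear_combination row_0110 n hd hPc
        · push_cast
          linear_combination row_1110 n hd hPc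
    · have hb2 : c41 ≤ 0 := by omega
      interval_cases c41
      · have hb1 : c21 ≤ 0 := by omega
        interval_cases c21
        · push_cast
          linear_combination row_0020 n hd hPc
  · have hb3 : c42 ≤ 0 := by omega
    interval_cases c42
    · have hb2 : c41 ≤ 1 := by omega
      interval_cases c41
      · have hb1 : c21 ≤ 1 := by omega
        interval_cases c21
        · push_cast
          linear_combination row_0001 n hd hPc
        · push_cast
          linear_combination row_1001 n hd hPc
      · have hb1 : c21 ≤ 0 := by omega
        interval_cases c21
        · push_cast
          linear_combination row_0101 n hd hPc

end PercRepro.PuncturedLYM.Split.TypeLift.MixP1Q2
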